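import Literature.MathematicalPhysics.QuantumLattice.ContinuumLimitLGT
import Literature.MathematicalPhysics.QuantumFieldTheory.YangMillsEuclidean
import Literature.MathematicalPhysics.QuantumFieldTheory.OSData
import HarnessLib

/-!
# `IsYangMillsFor`: OS data that ARE quantum Yang–Mills theory with compact simple gauge group `G`

Draft Literature file (docs/m5/drafts; D-0015/D-0017; ruling D-0018(2): Clay verbatim — every
compact simple `G`; mass gap of the FULL Hamiltonian, not of one field sector).

**Source (verbatim), Jaffe–Witten (Clay 2000).** §1 (1): "`L = (1/4g²) ∫ Tr F ∧ *F`, where Tr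
denotes an invariant quadratic form on the Lie algebra of `G`"; "every excitation of the vacuum
has energy at least `Δ`". §4: "define a quantum field theory (in the above sense) with local
quantum field operators in correspondence with the gauge-invariant local polynomials in the
curvature `F` and its covariant derivatives [fn. 1: A natural 1–1 correspondence … does not exist,
since the correspondence has some standard subtleties involving renormalization] … Prove that for
any compact simple gauge group `G`, a non-trivial quantum Yang–Mills theory exists on `ℝ⁴` and has
a mass gap `Δ > 0`." §5: "the existence of a uniform gap for finite-volume approximations may play
a fundamental role". §6: "the lattice approximation … verify the existence of limits of
appropriate expectations of gauge-invariant observables as the lattice spacing tends to zero and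
as the volume tends to infinity. Reflection positivity holds for the Wilson approximation."

**Renderings adopted (project decisions, recorded for the auditor).**
* *Compact simple Lie group.* Mathlib's `LieGroup` (manifolds) has no bridge to Haar measure or
  matrices; as in the tree (`QuantumLattice/GaugeGroups.lean`): a compact topological group with
  `IsSimpleCompactGroup G` (connected, non-abelian, no proper non-trivial closed connected normal
  subgroup) admitting a faithful continuous unitary matrix representation (closed subgroup of
  `U(N)` ⇒ compact Lie; conversely Peter–Weyl) — `LatticeRep G` (DATA: the "Tr" of (1) and of
  Wilson's action `β ∑ₚ Re tr ρ(U_p)`; for simple `G` invariant forms are proportional, the factor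
  absorbed in `β(a)`), `IsCompactSimpleLieGroup G`; `SU(n)` reduces to the tree's named fact.
* *Which fields ("generates").* Species `YMSpecies G := LocalGaugeObservable 4 G`: EVERY bounded
  measurable gauge-invariant cylinder function of the lattice gauge field (all Wilson loops, all
  bounded functions of finitely many). At each spacing these generate the full physical Hilbert
  space of the lattice theory [Osterwalder–Seiler 1978 §§2–3; Seiler 1982 Ch. 2]; their
  renormalised continuum limits are Jaffe–Witten's "gauge-invariant local polynomials in `F` …"
  (fn. 1: up to renormalisation). `IsYangMillsFor` ties the JOINT Schwinger functions of every
  species string to the lattice; `OSData.HasMassGap` clusters every species string = gap of `H` on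
  the full OS-reconstructed Hilbert space of `T`.
* *Continuum limit along a SEQUENCE of spacings* (human ruling 2026-08-15 on audit question Y2,
  after audits g3 #3, g4 N2, g6 Q1: "existence along a sequence `a_k → 0` (subsequential
  continuum limit), not the full filter — the full filter conflates uniqueness with existence"):
  a `SpeciesScheme` is indexed by `k : ℕ` with spacings `a_k > 0`, `a_k → 0`, `a_k L_k → ∞`
  (block-spin constructions control `a_k = L^{-k}` only; Jaffe–Witten §6 "limits … as the lattice
  spacing tends to zero"); every convergence/eventuality clause is `atTop` in `k`.
* *Full spectrum, witness-independently.* Renormalisations `(c_s, m_s)` are necessarily witness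
  data (fn. 1; non-scalar channels must be renormalised to `0` for E1), so a degenerate witness
  could present few non-zero species. `HasLatticeMassGap` closes this: at the SAME couplings
  `β(a)` the connected time-correlations of ALL pairs of gauge-invariant lattice observables decay
  at rate `Δ` in physical units on all tori at least as large as the scheme's (uniformly in the
  volume, audit g4 B2) — the lattice Hamiltonians have no spectrum in `(0, Δ)` on the full
  physical Hilbert space, uniformly along the sequence (Jaffe–Witten §1 (1), §5).
* *Weak-coupling continuum limit* (statement re-type 2026-08-16, semantic-vacuity audit §2.4-D /
  §4 item 4, human-approved): the inverse bare coupling of the scheme must run to infinity along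
  the sequence, `SpeciesScheme.HasWeakCouplingLimit sch := Tendsto sch.β atTop atTop` (`β = 2/g₀²`
  in the tree's normalisation, so `g₀(a_k) → 0`: the continuum limit is taken at the Gaussian
  ultraviolet fixed point of the asymptotically free theory, Jaffe–Witten §6, and not at a
  hypothetical finite-`β` critical point of Wilson's lattice theory). Before the re-type `β` was
  provably idle witness data (`IsYangMillsFor` never reads it: probe w2_1 of the audit). The
  minimal clause is used because the two-loop profile `β_k − afBeta_YM(G, r, Λ, a_k) → 0` (the
  analogue of `QCDScheme.HasAsymptoticScaling`) needs the one- and two-loop coefficients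
  `b₀ = 11 C₂(G)/(48π²)`, `b₁` in the normalisation fixed by `r`, i.e. Lie-algebra data (dual Coxeter
  number, Dynkin index of `r`) that the tree does not carry for an abstract compact group `G`;
  recorded as an open strengthening.
* *Placeholder content (not encoded).* The two-loop asymptotic-scaling profile (see above),
  universality (Wilson's action in `r` hard-coded), equations of motion, `a`-dependent operator
  mixing (fn. 1).
-/

open scoped SchwartzMap
open MeasureTheory Filter Topology
open Literature.MathematicalPhysics.AQFT Literature.MathematicalPhysics.QuantumLattice
open Literature.MathematicalPhysics.QuantumFieldTheory Literature.Probability.LatticeModels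

noncomputable section

namespace Literature.MathematicalPhysics.QuantumFieldTheory

/-- **Lattice representation data of `G`**: a faithful continuous unitary matrix representation
`ρ : G →* M_N(ℂ)` — the "Tr" (invariant form `X ↦ −tr ρ(X)²`) of Jaffe–Witten (1) and of Wilson's
action `β ∑ₚ Re tr ρ(U_p)`; its existence makes the compact group `G` a Lie group (tree:
`HasFaithfulUnitaryRep G N`). [cite: JaffeWitten2000, §1 (1) and §6] [cite: BrockerTomDieck1985, III (4.1)] -/
structure LatticeRep (G : Type*) [Group G] [TopologicalSpace G] where
  N : ℕ
  ρ : G →* Matrix (Fin N) (Fin N) ℂ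
  continuous : Continuous ρ
  injective : Function.Injective ρ
  mem_unitary : ∀ g, ρ g ∈ Matrix.unitaryGroup (Fin N) ℂ

/-- **`G` is a compact simple Lie group** (`G` a compact topological group): simple in the sense
of compact Lie groups (tree `IsSimpleCompactGroup`: connected, non-abelian, every closed connected
normal subgroup trivial or all — finite centre allowed, `SU(n)` qualifies) and linear (a faithful
continuous unitary representation exists ⇔ Lie; forces Hausdorff). [cite: Sepanski2007, Def. 1.34 and Thm. 3.28] [cite: BrockerTomDieck1985, III (4.1) and V (7.11)] -/
def IsCompactSimpleLieGroup (G : Type*) [Group G] [TopologicalSpace G] [CompactSpace G] : Prop :=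
  IsSimpleCompactGroup G ∧ Nonempty (LatticeRep G)

/-- **`SU(n)`, `n ≥ 2`, is a compact simple Lie group** — reduced to the tree's named (unproved)
fact `isSimpleCompactGroup_specialUnitaryGroup` (simplicity of `𝔰𝔲(n)`; faithfulness of the
fundamental representation is proved in the tree); consumed by the `SU(3)` instance of `YangMills`. [cite: BrockerTomDieck1985, I (1.10) and V (7.13)] -/
theorem isCompactSimpleLieGroup_specialUnitaryGroup
    (h : isSimpleCompactGroup_specialUnitaryGroup.{0}) {n : ℕ} (hn : 2 ≤ n) :
    IsCompactSimpleLieGroup (Matrix.specialUnitaryGroup (Fin n) ℂ) :=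
  ⟨h (by simpa using hn), ⟨⟨n, fundamentalRep (Fin n), continuous_fundamentalRep _,
    fundamentalRep_injective _, fundamentalRep_mem_unitaryGroup⟩⟩⟩

section Species

variable {G : Type} [Group G]

/-- The **Wilson action density at the origin** in the representation `ρ`,
`∑_{i<j} Re tr ρ(U_{p_{ij}(0)})` (six planes; hypercubic scalar, continuum `tr F_{μν}F_{μν}`).
[cite: Wilson1974] -/
def actionDensity {N : ℕ} (ρ : G →* Matrix (Fin N) (Fin N) ℂ) (U : LGConfig 4 G) : ℝ :=
  ∑ i : Fin 4, ∑ j : Fin 4, if i < j then plaquetteObs ρ 0 i j U else 0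

/-- The action density of a continuous representation is continuous. [folklore] -/
theorem continuous_actionDensity [TopologicalSpace G] [IsTopologicalGroup G] {N : ℕ}
    {ρ : G →* Matrix (Fin N) (Fin N) ℂ} (hρ : Continuous ρ) : Continuous (actionDensity ρ) := by
  refine continuous_finsetSum _ fun i _ => continuous_finsetSum _ fun j _ => ?_
  by_cases h : i < j <;> simp only [h, ↓reduceIte]
  exacts [continuous_plaquetteObs ρ hρ 0 i j, continuous_const]

variable [MeasurableSpace G]

variable (G) in
/-- **Species of the Yang–Mills OS data**: ALL bounded measurable gauge-invariant cylinder
functions of the lattice `G`-gauge field (tree `LocalGaugeObservable`); `OSData (YMSpecies G) 4` is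
OS data parametrised by the gauge group, one hermitian scalar field per such observable. [cite: OsterwalderSeiler1978, §2] [cite: JaffeWitten2000, §4] -/
abbrev YMSpecies : Type := LocalGaugeObservable 4 G

/-- The smeared, rescaled, renormalised local field on ONE real test function:
`Φ_a(f)(U) = c a⁴ ∑_{x ∈ Λ} f(a x) (O(τₓU) − m)`, `τₓU = configShift (−x) U`. [cite: JaffeWitten2000, §6] -/
def smearedLatticeField (O : LGConfig 4 G → ℝ) (Λ : Finset (Literature.Probability.LatticeModels.Site 4)) (a c m : ℝ)
    (f : 𝓢(EuclideanSpace ℝ (Fin 4), ℝ)) (U : LGConfig 4 G) : ℝ :=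
  c * a ^ 4 * ∑ x ∈ Λ, f (a • siteToE x) * (O (configShift (-x) U) - m)

variable [TopologicalSpace G] [IsTopologicalGroup G] [CompactSpace G] [BorelSpace G]

/-- **The curvature species** `tr F_{μν}F_{μν}` of `r`: the Wilson action density as a
gauge-invariant local observable (it carries the statement's non-triviality clauses; measurable by
second countability of `G`, from the closed embedding `r.ρ`). [cite: JaffeWitten2000, §4 (`Tr F_ij F_kl`)] [cite: Wilson1974] -/
def LatticeRep.curvature (r : LatticeRep G) : YMSpecies G :=
  haveI : SecondCountableTopology G :=
    (r.continuous.isClosedEmbedding r.injective).isEmbedding.secondCountableTopology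
  { F := actionDensity r.ρ
    supp := Finset.univ.biUnion fun p : Fin 4 × Fin 4 => originPlaquetteSupport p.1 p.2
    isCylinder := fun U V h => Finset.sum_congr rfl fun i _ => Finset.sum_congr rfl fun j _ => by
      by_cases hij : i < j <;> simp only [hij, ↓reduceIte]
      exact isCylinder_plaquetteObs_zero r.ρ i j
        (fun e he => h e (Finset.mem_biUnion.2 ⟨(i, j), Finset.mem_univ _, he⟩))
    gaugeInvariant := fun g U => Finset.sum_congr rfl fun i _ => Finset.sum_congr rfl fun j _ => by
      by_cases hij : i < j <;> simp only [hij, ↓reduceIte]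
      exact isZdGaugeInvariant_plaquetteObs r.ρ 0 i j g U
    bounded := by
      obtain ⟨C, hC⟩ := (isCompact_univ.image
        (continuous_abs.comp (continuous_actionDensity r.continuous))).isBounded.bddAbove
      exact ⟨C, fun U => hC ⟨U, Set.mem_univ _, rfl⟩⟩
    measurable := (continuous_actionDensity r.continuous).measurable }

/-- A **(sequential) scaling scheme** for species `ι`: lattice spacings `a_k > 0` with `a_k → 0`,
inverse bare couplings `β_k`, torus half-sides `L_k` with `a_k L_k → ∞`, per-species
multiplicative renormalisations `c_s(k)` and additive counterterms `m_s(k)` — witness DATA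
(Jaffe–Witten fn. 1; §6 "limits … as the lattice spacing tends to zero and as the volume tends
to infinity", along a sequence as in block-spin constructions `a_k = L^{-k}`; human ruling
2026-08-15, Y2). [cite: JaffeWitten2000, §4 fn. 1 and §6] -/
structure SpeciesScheme (ι : Type) where
  /-- lattice spacings -/
  a : ℕ → ℝ
  a_pos : ∀ k, 0 < a k
  tendsto_a : Tendsto a atTop (𝓝 0)
  /-- inverse bare couplings (tree normalisation of `wilsonMeasure`) -/
  β : ℕ → ℝ
  /-- torus half-sides -/
  L : ℕ → ℕ
  tendsto_L : Tendsto (fun k => a k * L k) atTop atTop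
  /-- multiplicative renormalisations -/
  c : ι → ℕ → ℝ
  /-- additive counterterms -/
  m : ι → ℕ → ℝ

namespace SpeciesScheme

variable {ι : Type}

/-- Torus side `2L_k+1`. [folklore] -/
def side (sch : SpeciesScheme ι) (k : ℕ) : ℕ := 2 * sch.L k + 1

/-- The side is never zero. [folklore] -/
instance neZero_side (sch : SpeciesScheme ι) (k : ℕ) : NeZero (sch.side k) := ⟨Nat.succ_ne_zero _⟩

variable (ι) in
/-- **The degenerate scheme** `a_k = 1/(k+1)`, `β = c = m ≡ 0`, `L_k = (k+1)²` (non-vacuity of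
the type). [folklore] -/
def zero : SpeciesScheme ι where
  a := fun k => ((k : ℝ) + 1)⁻¹
  a_pos := fun k => by positivity
  tendsto_a := tendsto_inv_atTop_zero.comp (tendsto_natCast_atTop_atTop.atTop_add tendsto_const_nhds)
  β := fun _ => 0
  L := fun k => (k + 1) ^ 2
  tendsto_L := by
    have h : (fun k : ℕ => ((k : ℝ) + 1)⁻¹ * (((k + 1) ^ 2 : ℕ) : ℝ)) = fun k : ℕ => (k : ℝ) + 1 := by
      funext k; push_cast; field_simp
    rw [h]
    exact tendsto_natCast_atTop_atTop.atTop_add tendsto_const_nhds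
  c := fun _ _ => 0
  m := fun _ _ => 0

/-- `zero` has `c ≡ 0`. [folklore] -/
@[simp] theorem zero_c (s : ι) (k : ℕ) : (zero ι).c s k = 0 := rfl

/-- `zero` has `β ≡ 0`. [folklore] -/
@[simp] theorem zero_β (k : ℕ) : (zero ι).β k = 0 := rfl

/-- **Weak-coupling continuum limit** (statement re-type 2026-08-16; semantic-vacuity audit
§2.4-D, §4 item 4): the inverse bare coupling `β_k = 2/g₀(a_k)²` fed to `wilsonMeasure` tends to
`+∞` along the sequence — the bare coupling `g₀ → 0` as `a_k → 0`, i.e. the continuum limit is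
the one at the asymptotically free (Gaussian) ultraviolet fixed point (Jaffe–Witten §1 "asymptotic
freedom", §6; Creutz (13.19)), excluding "continuum limits" at fixed or bounded `β` (strong
coupling, or a hypothetical finite-`β` critical point). Minimal, `G`-independent form of the
asymptotic-freedom side condition; the two-loop profile (QCD's `HasAsymptoticScaling`) is the
recorded strengthening once `b₀(G, r)`, `b₁(G, r)` are available as Lie-algebra data.
[cite: JaffeWitten2000, §1 and §6] [cite: Creutz2022, (13.19)] -/
def HasWeakCouplingLimit (sch : SpeciesScheme ι) : Prop :=
  Tendsto sch.β atTop atTop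

/-- A scheme whose inverse bare coupling is bounded above along the sequence (e.g. constant strong
coupling) is not a weak-coupling limit. [folklore] -/
theorem not_hasWeakCouplingLimit_of_le (sch : SpeciesScheme ι) {B : ℝ} (h : ∀ k, sch.β k ≤ B) :
    ¬ sch.HasWeakCouplingLimit := fun hw => by
  obtain ⟨k, hk⟩ := (tendsto_atTop.1 hw (B + 1)).exists
  linarith [h k]

/-- The degenerate scheme (`β ≡ 0`) is not a weak-coupling limit. [folklore] -/
theorem not_hasWeakCouplingLimit_zero : ¬ (zero ι).HasWeakCouplingLimit :=
  not_hasWeakCouplingLimit_of_le _ (B := 0) fun _ => le_rfl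

end SpeciesScheme

variable {N : ℕ} {ι : Type}

/-- **Joint lattice `n`-point function** of the species string `σ` at step `k` (spacing `a_k`):
`⟨∏ᵢ Φ^{σᵢ}_{a_k}(fᵢ)⟩ = ∫ ∏ᵢ Φ^{σᵢ}_{a_k}(fᵢ)(Ũ) dμ_{Λ_k,β_k}(U)` under Wilson's lattice measure in
the representation `ρ` on the torus of side `2L_k+1` (`Ũ` the periodic lift). [cite: JaffeWitten2000, §6] [cite: Wilson1974] -/
def latticeSchwinger (ρ : G →* Matrix (Fin N) (Fin N) ℂ) (sch : SpeciesScheme ι)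
    (obs : ι → LGConfig 4 G → ℝ) (k : ℕ) (n : ℕ) (σ : Fin n → ι)
    (f : Fin n → 𝓢(EuclideanSpace ℝ (Fin 4), ℝ)) : ℝ :=
  ∫ U, ∏ i, smearedLatticeField (obs (σ i)) (box 4 (sch.L k)) (sch.a k) (sch.c (σ i) k)
      (sch.m (σ i) k) (f i) (torusLift (sch.side k) U)
    ∂(wilsonMeasure (d := 4) (L := sch.side k) ρ (sch.β k))

/-- **Connected time-correlation on the torus** `⟨A · τ_{n e₀} B⟩ − ⟨A⟩⟨B⟩` under `wilsonMeasure ρ β`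
on the torus of side `S` (periodic lift; `τ` = translation by `n` lattice units in Euclidean time). [cite: OsterwalderSeiler1978, §2] -/
def latticeConnectedCorr (ρ : G →* Matrix (Fin N) (Fin N) ℂ) (β : ℝ) (S : ℕ) [NeZero S]
    (A B : LGConfig 4 G → ℝ) (n : ℕ) : ℝ :=
  (∫ U, A (torusLift S U) * B (configShift (-Pi.single 0 (n : ℤ)) (torusLift S U))
      ∂(wilsonMeasure (d := 4) (L := S) ρ β)) -
    (∫ U, A (torusLift S U) ∂(wilsonMeasure (d := 4) (L := S) ρ β)) *
      ∫ U, B (torusLift S U) ∂(wilsonMeasure (d := 4) (L := S) ρ β)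

/-! ### The interface predicates -/

/-- **`IsYangMillsFor r sch T`: the OS data `T` (one species per gauge-invariant local lattice
observable) ARE quantum Yang–Mills theory with gauge group `G`, regularised by Wilson's action in
the faithful representation `r`.** Along the sequential scheme `sch` (`a_k → 0`, `β_k`, `L_k`
with `a_k L_k → ∞`, species renormalisations `c_s(k), m_s(k)`), for every `n ≥ 1`, EVERY species
string `σ`, all real `fᵢ` and every tensor `F = f₁ ⊗ ⋯ ⊗ fₙ ∈ ⁰𝒮` (`IsOffDiagonal`), the joint
lattice `n`-point functions converge to `𝔖ₙ^σ(F)` as `k → ∞` — Jaffe–Witten §6, for ALL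
gauge-invariant observables jointly, so that the reconstructed Hilbert space of `T` is that of
the whole theory; along a SEQUENCE of spacings (existence, not uniqueness, of the continuum limit:
human ruling 2026-08-15, Y2).
**Definitional placeholder** for "is a Yang–Mills theory with gauge group `G`": inhabiting it (with
OS axioms, non-triviality, gap) IS the constructive content; Wilson's regularisation is hard-coded;
universality not asserted; the weak-coupling side condition `β_k → ∞` is the SEPARATE clause
`SpeciesScheme.HasWeakCouplingLimit` conjoined in the statement `YangMills` (this predicate does not
read `sch.β` beyond the lattice measure). [cite: JaffeWitten2000, §4 and §6] [cite: Wilson1974] [cite: OsterwalderSeiler1978, §2] -/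
def IsYangMillsFor (r : LatticeRep G) (sch : SpeciesScheme (YMSpecies G))
    (T : OSData (YMSpecies G) 4) : Prop :=
  ∀ (n : ℕ), n ≠ 0 → ∀ (σ : Fin n → YMSpecies G) (f : Fin n → 𝓢(EuclideanSpace ℝ (Fin 4), ℝ))
    (F : 𝓢((Fin n → EuclideanSpace ℝ (Fin 4)), ℂ)),
    IsTensorOf F (fun i => ofRealTest (f i)) → IsOffDiagonal F →
      Tendsto (fun k : ℕ => ((latticeSchwinger r.ρ sch (fun s => s.F) k n σ f : ℝ) : ℂ))
        atTop (𝓝 (T.schwinger n σ F))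

/-- **Uniform lattice mass gap `Δ` along the scheme, uniformly in the volume** (Jaffe–Witten §1
(1) "every excitation of the vacuum has energy at least `Δ`"; §5 "the existence of a uniform gap
for finite-volume approximations"): for every pair of gauge-invariant local lattice observables
`A, B` there is `C` such that for all large `k`, on EVERY periodic torus of side `2S+1` at least
the scheme's (`S ≥ L_k`), and for all time separations `n ≤ S`,
`|⟨A · τ_{n e₀}B⟩_{k,S} − ⟨A⟩_{k,S}⟨B⟩_{k,S}| ≤ C e^{−Δ a_k n}` at the scheme's coupling `β_k`.
Uniformity in `S` is what gives the clause spectral content (audit g4 B2): at fixed `k`, letting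
`S → ∞` bounds the time correlations for ALL `n`, so by the transfer matrix (`T_a ≥ 0` by
reflection positivity of Wilson's action) the spectral measure of every vector `ÂΩ_a` lies in
`{1} ∪ [0, e^{−aΔ}]`: the lattice Hamiltonians `H_a = −a⁻¹ log T_a` have no spectrum in `(0, Δ)`
on the FULL physical Hilbert space generated by all gauge-invariant observables, for all large
`k` — independently of the species renormalisations of the witness. (On the scheme's own tori
alone the bound would follow from the smallness `∼ a^8` of lattice-operator amplitudes whenever
`a_k · side_k = o(log a_k⁻¹)`, for every `Δ`.) [cite: JaffeWitten2000, §1 and §5] [cite: OsterwalderSeiler1978, §§2–3] [cite: Seiler1982, Ch. 2] -/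
def HasLatticeMassGap (r : LatticeRep G) (sch : SpeciesScheme ι) (Δ : ℝ) : Prop :=
  ∀ A B : YMSpecies G, ∃ C : ℝ, ∀ᶠ k in atTop, ∀ S : ℕ, sch.L k ≤ S → ∀ n : ℕ, n ≤ S →
    |latticeConnectedCorr r.ρ (sch.β k) (2 * S + 1) A.F B.F n| ≤
      C * Real.exp (-(Δ * (sch.a k * n)))

/-- **The degenerate scheme inhabits the placeholder**: with `c ≡ 0` all lattice correlations
vanish: the vacuum-only data satisfy `IsYangMillsFor` for every `G, r` (and every OS axiom and
`HasMassGap`; with `β ≡ 0` links are independent Haar variables, so `HasLatticeMassGap` holds too,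
while `HasWeakCouplingLimit` fails, `SpeciesScheme.not_hasWeakCouplingLimit_zero`) — which is why
the statement carries `IsNontrivial`/`IsNonGaussian` and `HasWeakCouplingLimit`. [folklore] -/
theorem isYangMillsFor_vacuum (r : LatticeRep G) :
    IsYangMillsFor r (SpeciesScheme.zero _) (OSData.vacuum (YMSpecies G) 4) := by
  intro n hn σ f F _ _
  have hS : (OSData.vacuum (YMSpecies G) 4).schwinger n σ F = 0 := by
    simp [OSData.vacuum, LabelledSchwingerFamily.trivial_of_ne_zero (YMSpecies G) hn]
  rw [hS]
  refine tendsto_const_nhds.congr' (Eventually.of_forall fun k => ?_)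
  show (0 : ℂ) = ((latticeSchwinger r.ρ (SpeciesScheme.zero _) (fun s => s.F) k n σ f : ℝ) : ℂ)
  obtain ⟨j, rfl⟩ := Nat.exists_eq_succ_of_ne_zero hn
  simp [latticeSchwinger, smearedLatticeField]

end Species

end Literature.MathematicalPhysics.QuantumFieldTheory

end
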